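/-
Copyright (c) 2026. All rights reserved.
Released under Apache 2.0 license as described in the file LICENSE.
Authors: abc-iut cell, prover seat abc-iut-L4-t15 (wave 2), over the statements of abc-iut-L4-t3.
-/
import Literature.AnabelianGeometry.AbsoluteAnabelian.Ltimes.LogFrobeniusCoresProofs
import Literature.AnabelianGeometry.AbsoluteAnabelian.LogFrobeniusMonoCoresProofs

/-!
# [AbsTopIII] Corollary 5.10 (iv)(a): the mono-analytic cores of `D•⊢` — `Cor510MonoCores` REDUCED to the mono-analyticization homotopies

S. Mochizuki, *Topics in absolute anabelian geometry III: global reconstruction algorithms*,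
J. Math. Sci. Univ. Tokyo 22 (2015) 939–1156 [MochizukiAbsTopIII2015]; locators `p.N` = pages of the author's
manuscript (`paper:url-5493eb38cbb7`), read on the page: Cor 5.10 preamble p. 146 (the diagram `D•⊢` and its
"mono-analyticization homotopies"), (iv)(a) p. 147, proof p. 149 l. 2–3 ("The various assertions of Corollary 5.10
are immediate from the definitions, together with the references quoted in the statement").

Proof-only companion (theorems only, no new notions) of abc-iut-L4-t3's `LogFrobeniusCorollaries.lean`, which
states Cor 5.10 (iv)(a) — "for `n = 5, 6, 7`, `D•⊢_{≤n}` admits a natural structure of core on the subdiagram of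
categories of `D•⊢` determined by the union `D•⊢_{≤n-1} ∪ D•_{≤n}` — i.e., loosely speaking, `ℰ⊢`, `An⊢[𝒩⊢⊞]` 'form
cores' of the functors in `D•⊢`" — as the named `Prop` fact `LogFrobeniusSetting.Cor510MonoCores L`.

WHAT IS PROVED.  The diagram `D•⊢` is obtained (p. 146) "by gluing `D•`, `D⊢` via [the] mono-analyticization
morphism" `D•_{≥3} → D⊢`, a morphism of diagrams of categories whose constituent "isomorphisms between composites
of functors" the text calls *mono-analyticization homotopies*, "e.g., the natural isomorphisms between the
functors associated to the two length 2 paths `𝒩⊞_v → 𝒩⊢⊞_v → 𝒩⊢_v`, `𝒩⊞_v → 𝒩_v → 𝒩⊢_v`".  The interface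
`LogFrobeniusSetting` (abc-iut-L4-t3, frozen) records that one square (`monoHomotopy`) but NOT the other squares of
the morphism `D•_{≥3} → D⊢`: rows 4 → 5 (`𝒩_v → ℰ• → ℰ⊢` versus `𝒩_v → 𝒩⊢_v → ℰ⊢`, the right-hand square of the
1-commutative diagrams of Def 5.6 (iii), (iv) pp. 135–136 after base-change to `[Z]`) and rows 6 → 7
(`An•[𝒳] → ℰ• → ℰ⊢` versus `An•[𝒳] → An⊢[𝒩⊢⊞] → ℰ⊢`).  We prove that `Cor510MonoCores L` holds for EVERY setting
with `V(F_mod) ≠ ∅` GIVEN these two mono-analyticization homotopies as hypotheses (`cor510MonoCores_of`): with them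
every vertex of `D•⊢` carries a structure functor towards `ℰ⊢` and every arrow of `D•⊢` lies over `ℰ⊢`, so
abc-iut-L4-t12's `DiagramCores` toolkit yields the three cores (over `ℰ⊢`, over `An⊢[𝒩⊢⊞]` through the equivalence of
Prop 5.8 (vii), over the `ℰ⊢` of row 7).  The rows-5 → 6 square needs no hypothesis: the arrow `An•[𝒳] → An⊢[𝒩⊢⊞]` IS
"induced, via `κ_{An•}` and the equivalence of Prop 5.8 (vii), by `ℰ• → ℰ⊢`" in the interface.  Without the two
homotopies the statement is NOT a formal consequence of the interface (the functors along the two length-2 paths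
`𝒩_v → ⋯ → ℰ⊢` are unrelated data there); per abc-iut-L4-t3 (INBOX 2026-08-25T22:39:57Z) they are stated here as
explicit hypotheses rather than by touching the frozen interface.  As for Cor 5.5 (i) (`LogFrobeniusCoresProofs`),
`V(F_mod) ≠ ∅` is necessary (`not_cor510MonoCores_of_isEmpty`).

Refereed pre-IUT material; nothing here bears on [IUTchIII] Cor. 3.12; OUR kernel check, no side taken.

**`⋉`-TWIN (cell row «LTIMES-SUCCESSOR», L4-lead m162; typing finding T3g9-F1).**  This file is the verbatim
re-elaboration of `LogFrobeniusMonoCoresProofs.lean` over the successor interface `LogFrobeniusSettingLtimes`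
(`Ltimes/LogFrobeniusCompatibility.lean`: `ι⊞_{v,ε}` indexed by the edges of `Γ⃗^⋉_v` at EVERY place, [AbsTopIII] Cor 5.5 (iii)
p. 131), produced by the cell recipe `LTIMES-RECIPE.md`: names carry over inside `namespace LogFrobeniusSettingLtimes`, the
section variable is `Lt`, setting-independent declarations are NOT repeated (the originals are in scope), statements and
proofs are otherwise unchanged.  The original file over the frozen interface stays as it is.
-/

set_option autoImplicit false

universe u

open CategoryTheory Quiver

namespace Literature.AnabelianGeometry.AbsoluteAnabelian

namespace LogFrobeniusSettingLtimes

variable {Vmod : Type u} {isArc : Vmod → Bool} (Lt : LogFrobeniusSettingLtimes Vmod isArc)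

export LogFrobeniusSetting (monoBase_of_inFirstRows_four monoBase_iff reach_emono5 reach_anMono reach_emono7)

/-! ## Reachability of the mono-analytic core vertices -/

/-! ## Corollary 5.10 (iv)(a) from the mono-analyticization homotopies -/

/-- **Cor 5.10 (iv)(a) (Mono-analytic Cores), REDUCED**: GIVEN the two mono-analyticization homotopies of the morphism
`D•_{≥3} → D⊢` (p. 146) that the interface `LogFrobeniusSetting` does not record — (`hN`) rows 4 → 5, "the natural
isomorphism between the functors associated to the two length 2 paths" `𝒩_v → 𝒩⊢_v → ℰ⊢` and `𝒩_v → ℰ• → ℰ⊢`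
(right-hand square of the 1-commutative diagram of Def 5.6 (iii)/(iv) pp. 135–136, base-changed to `[Z]`), and
(`hκ`) rows 6 → 7, `An•[𝒳] → ℰ• → ℰ⊢` versus `An•[𝒳] → An⊢[𝒩⊢⊞] → ℰ⊢` (equivalently `κ₂ ⋙ (ℰ• → ℰ⊢) ≅ κ_{An•}⁻¹ ⋙
(ℰ• → ℰ⊢)`, e.g. from `κ₂ ≅ κ_{An•}⁻¹`, Rmk 5.2.2) — "for `n = 5, 6, 7`, `D•⊢_{≤n}` admits a natural structure of
core on the subdiagram of categories of `D•⊢` determined by the union `D•⊢_{≤n-1} ∪ D•_{≤n}` — i.e., loosely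
speaking, `ℰ⊢`, `An⊢[𝒩⊢⊞]` 'form cores' of the functors in `D•⊢`" holds for every setting `L` with `V(F_mod) ≠ ∅`:
every vertex of `D•⊢` carries a structure functor towards `ℰ⊢` (`𝒳_⋎, □ ↦ (𝒳 → ℰ•) ⋙ (ℰ• → ℰ⊢)`, `𝒩⊞_v`, `𝒩_v`, `ℰ•`
likewise, `An•[𝒳] ↦ κ_{An•}⁻¹ ⋙ (ℰ• → ℰ⊢)`, `𝒩⊢⊞_w ↦ 𝒩⊢⊞_w → 𝒩⊢_w → ℰ⊢`, `𝒩⊢_w ↦ (𝒩⊢_w → ℰ⊢)`, `ℰ⊢ ↦ id`, `An⊢ ↦` the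
inverse of the Prop 5.8 (vii) equivalence) and EVERY arrow of `D•⊢` lies over `ℰ⊢` by `logOver`, `lamOver`,
`monoHomotopy`, `hN`, `hκ` and the unit isomorphisms of `κ_{An•}`, `κ_{An⊢}`; then abc-iut-L4-t12's `DiagramCores`
gives the three cores (the proof the text calls "immediate from the definitions", p. 149).
[cite: MochizukiAbsTopIII2015, Cor 5.10 (iv)(a) p.147] -/
theorem cor510MonoCores_of [Nonempty Vmod]
    (hN : ∀ v : Vmod, Nonempty (Lt.monoN v ⋙ Lt.toEmono v ≅ Lt.toE v ⋙ Lt.monoAn))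
    (hκ : Nonempty (Lt.κAn₂.functor ⋙ Lt.monoAn ≅ Lt.κAn.inverse ⋙ Lt.monoAn)) : Lt.Cor510MonoCores := by
  -- the structure functors of ALL vertices of `D•⊢` over `ℰ⊢`
  let N : (x : DVertex Vmod isArc) → (x.categoryLtimes Lt ⥤ Lt.Emono) := fun x =>
    match x with
    | .row1 _ => Lt.proj ⋙ Lt.monoAn
    | .core => Lt.proj ⋙ Lt.monoAn
    | .nplus v => (Lt.forget v ⋙ Lt.toE v) ⋙ Lt.monoAn
    | .nv v => Lt.toE v ⋙ Lt.monoAn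
    | .e5 => Lt.monoAn
    | .an => Lt.κAn.inverse ⋙ Lt.monoAn
    | .e7 => Lt.monoAn
    | .nmonoPlus w => Lt.forgetMono w ⋙ Lt.toEmono w
    | .nmono w => Lt.toEmono w
    | .emono5 => 𝟭 Lt.Emono
    | .anMono => Lt.κAnMono.inverse
    | .emono7 => 𝟭 Lt.Emono
  -- every arrow of `D•⊢` lies over `ℰ⊢`
  have μ : ∀ {a b : DVertex Vmod isArc} (e : DEdge isArc a b), (DEdge.functorLtimes Lt e ⋙ N b ≅ N a) := fun {a b} e =>
    match a, b, e with
    | _, _, .log _ => (Functor.associator _ _ _).symm ≪≫ Functor.isoWhiskerRight Lt.logOver Lt.monoAn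
    | _, _, .toCore _ => Functor.leftUnitor _
    | _, _, .lam v ν _ => (Functor.associator _ _ _).symm ≪≫ Functor.isoWhiskerRight (Lt.lamOver v ν) Lt.monoAn
    | _, _, .forget _ => (Functor.associator _ _ _).symm
    | _, _, .toE _ => Iso.refl _
    | _, _, .κAn => (Functor.associator _ _ _).symm ≪≫ Functor.isoWhiskerRight Lt.κAn.unitIso.symm Lt.monoAn ≪≫
        Lt.monoAn.leftUnitor
    | _, _, .anToE => hκ.some
    | _, _, .monoNplus v => (Functor.associator _ _ _).symm ≪≫
        Functor.isoWhiskerRight (Lt.monoHomotopy v) (Lt.toEmono v) ≪≫ Functor.associator _ _ _ ≪≫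
        Functor.isoWhiskerLeft (Lt.forget v) (hN v).some ≪≫ (Functor.associator _ _ _).symm
    | _, _, .monoN v => (hN v).some
    | _, _, .monoE5 => Functor.rightUnitor _
    | _, _, .monoAn => Functor.associator _ _ _ ≪≫ Functor.isoWhiskerLeft Lt.κAn.inverse
        (Functor.associator _ _ _ ≪≫ Functor.isoWhiskerLeft Lt.monoAn Lt.κAnMono.unitIso.symm ≪≫ Lt.monoAn.rightUnitor)
    | _, _, .monoE7 => Functor.rightUnitor _
    | _, _, .forgetMono _ => Iso.refl _
    | _, _, .toEmono _ => Functor.rightUnitor _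
    | _, _, .κAnMono => Lt.κAnMono.unitIso.symm
    | _, _, .anMonoToE => Functor.rightUnitor _
  -- the induced structure functors on `D•⊢_{≤n-1} ∪ D•_{≤n}` over any category under `ℰ⊢`
  let O : (n : ℕ) → {C : Type (u + 1)} → [Category.{u} C] → (Lt.Emono ⥤ C) →
      (Lt.subdiagram (monoBase n)).OverData C := fun n _ _ G =>
    { N := fun a => N a.1 ⋙ G
      μ := fun {a b} e => (Functor.associator _ _ _).symm ≪≫ Functor.isoWhiskerRight (μ e) G }
  refine ⟨?_, ?_, ?_⟩
  · -- `n = 5`: `ℰ⊢` is a core of `D•⊢_{≤4} ∪ D•_{≤5}`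
    exact Lt.isCoreOn_of_overData (O 5 (𝟭 Lt.Emono))
      (fun a i => match a, i with
        | ⟨_, _⟩, .monoE5 => (Functor.rightUnitor _).symm
        | ⟨_, _⟩, .toEmono _ => (Functor.rightUnitor _).symm)
      reach_emono5
  · -- `n = 6`: `An⊢[𝒩⊢⊞]` is a core of `D•⊢_{≤5} ∪ D•_{≤6}` (over `An⊢[𝒩⊢⊞]` through the Prop 5.8 (vii) equivalence)
    exact Lt.isCoreOn_of_overData (O 6 Lt.κAnMono.functor)
      (fun a i => match a, i with
        | ⟨_, _⟩, .monoAn => (Functor.associator _ _ _).symm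
        | ⟨_, _⟩, .κAnMono => (Functor.leftUnitor _).symm)
      reach_anMono
  · -- `n = 7`: the `ℰ⊢` of row 7 is a core of `D•⊢_{≤6} ∪ D•_{≤7}`
    exact Lt.isCoreOn_of_overData (O 7 (𝟭 Lt.Emono))
      (fun a i => match a, i with
        | ⟨_, _⟩, .monoE7 => (Functor.rightUnitor _).symm
        | ⟨_, _⟩, .anMonoToE => (Functor.rightUnitor _).symm)
      reach_emono7

/-- The rows-6 → 7 homotopy `hκ` in the form Rmk 5.2.2 suggests: it holds as soon as the second equivalence
`An•[𝒳] ⥲ ℰ•` is isomorphic to the quasi-inverse of `κ_{An•}`. [cite: MochizukiAbsTopIII2015, Rmk 5.2.2 p.121] -/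
theorem nonempty_hκ_of_iso (h : Nonempty (Lt.κAn₂.functor ≅ Lt.κAn.inverse)) :
    Nonempty (Lt.κAn₂.functor ⋙ Lt.monoAn ≅ Lt.κAn.inverse ⋙ Lt.monoAn) :=
  ⟨Functor.isoWhiskerRight h.some Lt.monoAn⟩

/-! ## The degenerate corner `V(F_mod) = ∅` -/

/-- **`V(F_mod) ≠ ∅` is necessary** for `Cor510MonoCores` as typed (whatever the homotopies): with `Vmod` empty the
vertex `□` of `D•⊢_{≤4} ∪ D•_{≤5}` reaches no `ℰ⊢`. [cite: MochizukiAbsTopIII2015, Cor 5.10 (iv)(a) p.147] -/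
theorem not_cor510MonoCores_of_isEmpty [IsEmpty Vmod] : ¬ Lt.Cor510MonoCores := by
  rintro ⟨⟨H, hH, hcore⟩, -, -⟩
  have hc : monoBase (Vmod := Vmod) (isArc := isArc) 5 .core := Or.inl ⟨trivial, by simp [DVertex.row]⟩
  obtain ⟨p⟩ := hcore.reaches_obs ⟨.core, hc⟩
  have h := eq_core_of_path_of_isEmpty (P := monoBase 5) hc (x := .emono5) (fun i => by cases i) p
  change ExtVertex.obs = ExtVertex.base _ at h
  cases h

end LogFrobeniusSettingLtimes

end Literature.AnabelianGeometry.AbsoluteAnabelian
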